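import Mathlib.NumberTheory.EulerProduct.Basic
import Mathlib.NumberTheory.SumPrimeReciprocals
import Mathlib.Analysis.SpecialFunctions.Log.Basic
import Mathlib.Analysis.SpecialFunctions.Pow.Continuity
import Mathlib.Analysis.SpecificLimits.Normed
import Mathlib.Analysis.Normed.Group.Tannery
import HarnessLib

/-!
# The logarithm of an Euler product near `s = 1`

Topic `Literature/NumberTheory/LFunctions`. Everything in this file is PROVED (no `sorry`).

Let `c : ℕ → ℕ` be multiplicative on coprime arguments with `c 1 = 1` and polynomially bounded
on prime powers, `c(p^e) ≤ (e+1)^D`, and suppose the Dirichlet series `Z(s) = Σ c(n) n^{-s}`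
converges for real `s > 1` and has a "simple pole" at `s = 1` in the weak sense
`(s - 1) Z(s) → ρ > 0` (`s → 1⁺`). Then (main result, `Literature.NumberTheory.LFunctions.LogEulerProduct.tendsto_tsum_primes_add_log`)

  `Σ_p c(p) p^{-s} + log (s - 1) ⟶ L`  as `s → 1⁺`

for some real `L`. This is the classical first step of Dirichlet/Landau density arguments
(`log ζ_K(s) = Σ_𝔭 N𝔭^{-s} + O(1) = Σ_p r₁(p) p^{-s} + O(1)`); we use it with
`c(n) = #{ideals of norm n}` of a number field (`IdealNormCount.lean`) and with `c ≡ 1`.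

Proof: the Euler product (Mathlib `EulerProduct.eulerProduct`) gives
`log Z(s) = Σ_p log E_p(s)` with `E_p(s) = Σ_e c(p^e) p^{-es} = 1 + c(p)p^{-s} + T_p(s)`,
`0 ≤ T_p(s) ≤ A_D p^{-2s}`; with `0 ≤ x - log(1+x) ≤ x²` (`x ≥ 0`) this gives
`|log E_p(s) - c(p)p^{-s}| ≤ B_D p^{-2}` uniformly in `s ≥ 1`, and Tannery's theorem
(`tendsto_tsum_of_dominated_convergence`) lets `s → 1⁺` in the error series.

## References

* W. Narkiewicz, *Elementary and Analytic Theory of Algebraic Numbers*, 3rd ed., Springer 2004,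
  Ch. 7 §1 (Dedekind zeta, `log ζ_K(s) = Σ N𝔭^{-s} + g(s)` with `g` regular at `1`). [folklore]
* D. A. Marcus, *Number Fields*, Springer 1977, Ch. 7 (densities of primes via `log ζ_K`).
-/

noncomputable section

open Filter Topology Nat Finset Real

namespace Literature.NumberTheory.LFunctions

namespace LogEulerProduct

/-! ### Elementary inequalities -/

/-- `|log (1 + x) - x| ≤ x²` for `x ≥ 0`. [folklore] -/
lemma abs_log_one_add_sub_le_sq {x : ℝ} (hx : 0 ≤ x) : |Real.log (1 + x) - x| ≤ x ^ 2 := by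
  have h1 : Real.log (1 + x) ≤ x := by
    have := Real.log_le_sub_one_of_pos (show 0 < 1 + x by linarith)
    linarith
  have h2 : x - x ^ 2 ≤ Real.log (1 + x) := by
    have h := Real.one_sub_inv_le_log_of_pos (show 0 < 1 + x by linarith)
    have : x - x ^ 2 ≤ 1 - (1 + x)⁻¹ := by
      rw [show 1 - (1 + x)⁻¹ = x / (1 + x) by field_simp; ring]
      rw [le_div_iff₀ (by linarith)]
      nlinarith [sq_nonneg x, mul_nonneg hx (sq_nonneg x)]
    linarith
  rw [abs_le]
  constructor <;> linarith

/-- For a prime `p`, real `s ≥ 1` and `e : ℕ`: `((p:ℝ)^e)^(-s) ≤ (1/2)^e`. [folklore] -/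
lemma pow_rpow_neg_le_half_pow {p : ℕ} (hp : 2 ≤ p) {s : ℝ} (hs : 1 ≤ s) (e : ℕ) :
    ((p : ℝ) ^ e) ^ (-s) ≤ (1 / 2 : ℝ) ^ e := by
  have hp0 : (0 : ℝ) < p := by exact_mod_cast (show 0 < p by omega)
  have hp2 : (2 : ℝ) ≤ p := by exact_mod_cast hp
  rw [← Real.rpow_natCast, ← Real.rpow_mul hp0.le, mul_comm, Real.rpow_mul hp0.le,
    Real.rpow_natCast]
  refine pow_le_pow_left₀ (Real.rpow_nonneg hp0.le _) ?_ e
  rw [Real.rpow_neg hp0.le, one_div]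
  refine inv_anti₀ (by norm_num) ?_
  calc (2 : ℝ) = 2 ^ (1 : ℝ) := by simp
    _ ≤ (p : ℝ) ^ (1 : ℝ) := by
        exact Real.rpow_le_rpow (by norm_num) hp2 (by norm_num)
    _ ≤ (p : ℝ) ^ s := Real.rpow_le_rpow_of_exponent_le (by linarith) hs

/-- `((p:ℝ)^e)^(-s) = ((p:ℝ)^(-s))^e`. [folklore] -/
lemma pow_rpow_neg_eq {p : ℕ} (e : ℕ) (s : ℝ) :
    ((p : ℝ) ^ e) ^ (-s) = ((p : ℝ) ^ (-s)) ^ e := by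
  have hp0 : (0 : ℝ) ≤ p := Nat.cast_nonneg _
  rw [← Real.rpow_natCast, ← Real.rpow_mul hp0, mul_comm, Real.rpow_mul hp0, Real.rpow_natCast]

/-! ### The setting -/

variable {c : ℕ → ℕ} {D : ℕ}

/-- The Dirichlet-series term `f_s(n) = c(n) n^{-s}` (real `s`). [folklore] -/
def term (c : ℕ → ℕ) (s : ℝ) (n : ℕ) : ℝ := (c n : ℝ) * (n : ℝ) ^ (-s)

/-- Auxiliary (proof-internal). [folklore] -/
lemma term_nonneg (s : ℝ) (n : ℕ) : 0 ≤ term c s n :=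
  mul_nonneg (Nat.cast_nonneg _) (Real.rpow_nonneg (Nat.cast_nonneg _) _)

/-- Auxiliary (proof-internal). [folklore] -/
lemma term_zero {s : ℝ} (hs : 0 < s) : term c s 0 = 0 := by
  simp [term, Real.zero_rpow (by linarith : -s ≠ 0)]

/-- Auxiliary (proof-internal). [folklore] -/
lemma term_one (h1 : c 1 = 1) (s : ℝ) : term c s 1 = 1 := by
  simp [term, h1]

/-- Auxiliary (proof-internal). [folklore] -/
lemma term_mul (hmul : ∀ m n : ℕ, m.Coprime n → c (m * n) = c m * c n) (s : ℝ) {m n : ℕ}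
    (hmn : m.Coprime n) : term c s (m * n) = term c s m * term c s n := by
  simp only [term, hmul m n hmn, Nat.cast_mul]
  rw [Real.mul_rpow (Nat.cast_nonneg _) (Nat.cast_nonneg _)]
  ring

/-- The Euler factor `E_p(s) = Σ_e c(p^e) p^{-es}`. [folklore] -/
def eulerFactor (c : ℕ → ℕ) (s : ℝ) (p : ℕ) : ℝ := ∑' e : ℕ, term c s (p ^ e)

/-- The constant `A_D = Σ_e (e+3)^D 2^{-e}` bounding the tails of the Euler factors. [folklore] -/
def tailConst (D : ℕ) : ℝ := ∑' e : ℕ, ((e : ℝ) + 3) ^ D * (1 / 2 : ℝ) ^ e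

/-- Auxiliary (proof-internal). [folklore] -/
lemma summable_tailConst (D : ℕ) :
    Summable fun e : ℕ => ((e : ℝ) + 3) ^ D * (1 / 2 : ℝ) ^ e := by
  have h := summable_pow_mul_geometric_of_norm_lt_one D (r := (1 / 2 : ℝ)) (by norm_num)
  -- shift by 3
  have h3 := (summable_nat_add_iff 3).mpr h
  have : (fun e : ℕ => ((e : ℝ) + 3) ^ D * (1 / 2 : ℝ) ^ e) =
      fun e : ℕ => (8 : ℝ) * (((e + 3 : ℕ) : ℝ) ^ D * (1 / 2 : ℝ) ^ (e + 3)) := by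
    ext e
    push_cast
    ring
  rw [this]
  exact h3.mul_left 8

/-- Auxiliary (proof-internal). [folklore] -/
lemma tailConst_nonneg (D : ℕ) : 0 ≤ tailConst D :=
  tsum_nonneg fun _ => by positivity

/-- Term bound on prime powers: `c(p^e) ((p^e))^{-s} ≤ (e+1)^D (1/2)^e` for `s ≥ 1`. [folklore] -/
lemma term_prime_pow_le (hpp : ∀ p e : ℕ, p.Prime → (c (p ^ e) : ℝ) ≤ ((e : ℝ) + 1) ^ D)
    {p : ℕ} (hp : p.Prime) {s : ℝ} (hs : 1 ≤ s) (e : ℕ) :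
    term c s (p ^ e) ≤ ((e : ℝ) + 1) ^ D * (1 / 2 : ℝ) ^ e := by
  unfold term
  push_cast
  exact mul_le_mul (hpp p e hp) (pow_rpow_neg_le_half_pow hp.two_le hs e)
    (Real.rpow_nonneg (by positivity) _) (by positivity)

/-- Auxiliary (proof-internal). [folklore] -/
lemma summable_term_prime_pow (hpp : ∀ p e : ℕ, p.Prime → (c (p ^ e) : ℝ) ≤ ((e : ℝ) + 1) ^ D)
    {p : ℕ} (hp : p.Prime) {s : ℝ} (hs : 1 ≤ s) :
    Summable fun e : ℕ => term c s (p ^ e) := by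
  refine Summable.of_nonneg_of_le (fun e => term_nonneg _ _) (fun e => term_prime_pow_le hpp hp hs e) ?_
  have h := summable_pow_mul_geometric_of_norm_lt_one D (r := (1 / 2 : ℝ)) (by norm_num)
  have h1 := (summable_nat_add_iff 1).mpr h
  have : (fun e : ℕ => ((e : ℝ) + 1) ^ D * (1 / 2 : ℝ) ^ e) =
      fun e : ℕ => (2 : ℝ) * (((e + 1 : ℕ) : ℝ) ^ D * (1 / 2 : ℝ) ^ (e + 1)) := by
    ext e; push_cast; ring
  rw [this]
  exact h1.mul_left 2

/-- The tail `T_p(s) = Σ_{e ≥ 2} c(p^e) p^{-es}`. [folklore] -/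
def tail (c : ℕ → ℕ) (s : ℝ) (p : ℕ) : ℝ := ∑' e : ℕ, term c s (p ^ (e + 2))

/-- Auxiliary (proof-internal). [folklore] -/
lemma tail_nonneg (s : ℝ) (p : ℕ) : 0 ≤ tail c s p :=
  tsum_nonneg fun _ => term_nonneg _ _

/-- `E_p(s) = 1 + c(p) p^{-s} + T_p(s)`. [folklore] -/
lemma eulerFactor_eq (h1 : c 1 = 1)
    (hpp : ∀ p e : ℕ, p.Prime → (c (p ^ e) : ℝ) ≤ ((e : ℝ) + 1) ^ D)
    {p : ℕ} (hp : p.Prime) {s : ℝ} (hs : 1 ≤ s) :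
    eulerFactor c s p = 1 + term c s p + tail c s p := by
  unfold eulerFactor tail
  rw [← Summable.sum_add_tsum_nat_add 2 (summable_term_prime_pow hpp hp hs)]
  simp [Finset.sum_range_succ, term_one h1]

/-- `T_p(s) ≤ A_D · (p^{-s})²` for `s ≥ 1`. [folklore] -/
lemma tail_le (hpp : ∀ p e : ℕ, p.Prime → (c (p ^ e) : ℝ) ≤ ((e : ℝ) + 1) ^ D)
    {p : ℕ} (hp : p.Prime) {s : ℝ} (hs : 1 ≤ s) :
    tail c s p ≤ tailConst D * ((p : ℝ) ^ (-s)) ^ 2 := by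
  have hp0 : (0 : ℝ) < p := by exact_mod_cast hp.pos
  set q : ℝ := (p : ℝ) ^ (-s) with hq
  have hq0 : 0 ≤ q := Real.rpow_nonneg hp0.le _
  have hqhalf : q ≤ 1 / 2 := by
    have := pow_rpow_neg_le_half_pow hp.two_le hs 1
    simpa [hq] using this
  -- termwise bound: term (p^(e+2)) = c(p^(e+2)) q^(e+2) ≤ (e+3)^D q^2 (1/2)^e
  have hle : ∀ e : ℕ, term c s (p ^ (e + 2)) ≤ tailConst D * 0 + ((e : ℝ) + 3) ^ D * (1 / 2 : ℝ) ^ e * q ^ 2 := by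
    intro e
    rw [mul_zero, zero_add]
    have hc : (c (p ^ (e + 2)) : ℝ) ≤ ((e : ℝ) + 3) ^ D := by
      have := hpp p (e + 2) hp; push_cast at this; convert this using 2; ring
    have hpow : ((p ^ (e + 2) : ℕ) : ℝ) ^ (-s) = q ^ e * q ^ 2 := by
      push_cast
      rw [pow_rpow_neg_eq, pow_add]
    unfold term
    rw [hpow]
    calc (c (p ^ (e + 2)) : ℝ) * (q ^ e * q ^ 2)
        ≤ ((e : ℝ) + 3) ^ D * ((1 / 2 : ℝ) ^ e * q ^ 2) := by
          refine mul_le_mul hc ?_ (by positivity) (by positivity)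
          exact mul_le_mul_of_nonneg_right (pow_le_pow_left₀ hq0 hqhalf e) (by positivity)
      _ = ((e : ℝ) + 3) ^ D * (1 / 2 : ℝ) ^ e * q ^ 2 := by ring
  have hsum : Summable fun e : ℕ => ((e : ℝ) + 3) ^ D * (1 / 2 : ℝ) ^ e * q ^ 2 :=
    (summable_tailConst D).mul_right _
  unfold tail
  calc ∑' e : ℕ, term c s (p ^ (e + 2))
      ≤ ∑' e : ℕ, ((e : ℝ) + 3) ^ D * (1 / 2 : ℝ) ^ e * q ^ 2 :=
        Summable.tsum_le_tsum (fun e => by simpa using hle e)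
          ((summable_nat_add_iff 2).mpr (summable_term_prime_pow hpp hp hs)) hsum
    _ = tailConst D * q ^ 2 := by rw [tsum_mul_right]; rfl

/-- `c(p) p^{-s} ≤ 2^D p^{-s}`. [folklore] -/
lemma term_prime_le (hpp : ∀ p e : ℕ, p.Prime → (c (p ^ e) : ℝ) ≤ ((e : ℝ) + 1) ^ D)
    {p : ℕ} (hp : p.Prime) (s : ℝ) : term c s p ≤ (2 : ℝ) ^ D * (p : ℝ) ^ (-s) := by
  unfold term
  refine mul_le_mul_of_nonneg_right ?_ (Real.rpow_nonneg (Nat.cast_nonneg _) _)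
  have := hpp p 1 hp
  norm_num at this
  exact this

/-- The uniform constant `B_D = (2^D + A_D)² + A_D`. [folklore] -/
def errConst (D : ℕ) : ℝ := ((2 : ℝ) ^ D + tailConst D) ^ 2 + tailConst D

/-- The error term `r_p(s) = log E_p(s) - c(p) p^{-s}`. [folklore] -/
def err (c : ℕ → ℕ) (s : ℝ) (p : ℕ) : ℝ := Real.log (eulerFactor c s p) - term c s p

/-- Uniform bound `|log E_p(s) - c(p)p^{-s}| ≤ B_D p^{-2}` for `s ≥ 1`. [folklore] -/
lemma abs_err_le (h1 : c 1 = 1)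
    (hpp : ∀ p e : ℕ, p.Prime → (c (p ^ e) : ℝ) ≤ ((e : ℝ) + 1) ^ D)
    {p : ℕ} (hp : p.Prime) {s : ℝ} (hs : 1 ≤ s) :
    |err c s p| ≤ errConst D * (p : ℝ) ^ (-2 : ℝ) := by
  have hp0 : (0 : ℝ) < p := by exact_mod_cast hp.pos
  set q : ℝ := (p : ℝ) ^ (-s) with hq
  have hq0 : 0 ≤ q := Real.rpow_nonneg hp0.le _
  have hq1 : q ≤ 1 := by
    rw [hq, Real.rpow_neg hp0.le]
    exact inv_le_one_of_one_le₀ (Real.one_le_rpow (by exact_mod_cast hp.one_lt.le) (by linarith))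
  -- q^2 ≤ p^{-2}
  have hq2 : q ^ 2 ≤ (p : ℝ) ^ (-2 : ℝ) := by
    rw [hq, ← Real.rpow_natCast, ← Real.rpow_mul hp0.le]
    refine Real.rpow_le_rpow_of_exponent_le (by exact_mod_cast hp.one_lt.le) ?_
    push_cast; linarith
  set x : ℝ := term c s p + tail c s p with hx
  have hx0 : 0 ≤ x := add_nonneg (term_nonneg _ _) (tail_nonneg _ _)
  have hE : eulerFactor c s p = 1 + x := by rw [eulerFactor_eq h1 hpp hp hs, hx]; ring
  have hxle : x ≤ ((2 : ℝ) ^ D + tailConst D) * q := by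
    have ht := tail_le hpp hp hs
    have htm := term_prime_le hpp hp s
    rw [← hq] at ht htm
    have : tailConst D * q ^ 2 ≤ tailConst D * q := by
      refine mul_le_mul_of_nonneg_left ?_ (tailConst_nonneg D)
      nlinarith
    calc x ≤ (2 : ℝ) ^ D * q + tailConst D * q := by rw [hx]; linarith
      _ = ((2 : ℝ) ^ D + tailConst D) * q := by ring
  have hAt : 0 ≤ (2 : ℝ) ^ D + tailConst D := add_nonneg (by positivity) (tailConst_nonneg D)
  calc |err c s p| = |(Real.log (1 + x) - x) + tail c s p| := by
        rw [err, hE, hx]; ring_nf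
    _ ≤ |Real.log (1 + x) - x| + |tail c s p| := abs_add_le _ _
    _ ≤ x ^ 2 + tailConst D * q ^ 2 := by
        refine add_le_add (abs_log_one_add_sub_le_sq hx0) ?_
        rw [abs_of_nonneg (tail_nonneg _ _)]
        simpa [hq] using tail_le hpp hp hs
    _ ≤ (((2 : ℝ) ^ D + tailConst D) * q) ^ 2 + tailConst D * q ^ 2 := by
        gcongr
    _ = errConst D * q ^ 2 := by rw [errConst]; ring
    _ ≤ errConst D * (p : ℝ) ^ (-2 : ℝ) := by
        refine mul_le_mul_of_nonneg_left hq2 ?_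
        exact add_nonneg (sq_nonneg _) (tailConst_nonneg D)

/-! ### Continuity of the Euler factors at `s = 1⁺` -/

/-- Auxiliary (proof-internal). [folklore] -/
lemma tendsto_term {n : ℕ} (hn : n ≠ 0) (s₀ : ℝ) :
    Tendsto (fun s : ℝ => term c s n) (𝓝 s₀) (𝓝 (term c s₀ n)) := by
  unfold term
  refine Tendsto.const_mul _ ?_
  have hn' : (n : ℝ) ≠ 0 := by exact_mod_cast hn
  exact (Real.continuousAt_const_rpow hn').tendsto.comp tendsto_id.neg

/-- `E_p(s) → E_p(1)` as `s → 1⁺` (Tannery over `e`). [folklore] -/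
lemma tendsto_eulerFactor (hpp : ∀ p e : ℕ, p.Prime → (c (p ^ e) : ℝ) ≤ ((e : ℝ) + 1) ^ D)
    {p : ℕ} (hp : p.Prime) :
    Tendsto (fun s : ℝ => eulerFactor c s p) (𝓝[>] 1) (𝓝 (eulerFactor c 1 p)) := by
  unfold eulerFactor
  refine tendsto_tsum_of_dominated_convergence
    (bound := fun e : ℕ => ((e : ℝ) + 1) ^ D * (1 / 2 : ℝ) ^ e) ?_ ?_ ?_
  · have h := summable_pow_mul_geometric_of_norm_lt_one D (r := (1 / 2 : ℝ)) (by norm_num)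
    have h1 := (summable_nat_add_iff 1).mpr h
    have : (fun e : ℕ => ((e : ℝ) + 1) ^ D * (1 / 2 : ℝ) ^ e) =
        fun e : ℕ => (2 : ℝ) * (((e + 1 : ℕ) : ℝ) ^ D * (1 / 2 : ℝ) ^ (e + 1)) := by
      ext e; push_cast; ring
    rw [this]
    exact h1.mul_left 2
  · intro e
    exact tendsto_nhdsWithin_of_tendsto_nhds
      (tendsto_term (pow_ne_zero e hp.ne_zero) 1)
  · filter_upwards [self_mem_nhdsWithin] with s (hs : 1 < s)
    intro e
    rw [Real.norm_eq_abs, abs_of_nonneg (term_nonneg _ _)]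
    exact term_prime_pow_le hpp hp hs.le e

/-- Auxiliary (proof-internal). [folklore] -/
lemma eulerFactor_pos (h1 : c 1 = 1)
    (hpp : ∀ p e : ℕ, p.Prime → (c (p ^ e) : ℝ) ≤ ((e : ℝ) + 1) ^ D)
    {p : ℕ} (hp : p.Prime) {s : ℝ} (hs : 1 ≤ s) : 0 < eulerFactor c s p := by
  rw [eulerFactor_eq h1 hpp hp hs]
  have := term_nonneg (c := c) s p
  have := tail_nonneg (c := c) s p
  linarith

/-- `r_p(s) → r_p(1)` as `s → 1⁺`. [folklore] -/
lemma tendsto_err (h1 : c 1 = 1)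
    (hpp : ∀ p e : ℕ, p.Prime → (c (p ^ e) : ℝ) ≤ ((e : ℝ) + 1) ^ D)
    {p : ℕ} (hp : p.Prime) :
    Tendsto (fun s : ℝ => err c s p) (𝓝[>] 1) (𝓝 (err c 1 p)) := by
  unfold err
  refine Tendsto.sub ?_ (tendsto_nhdsWithin_of_tendsto_nhds (tendsto_term hp.ne_zero 1))
  exact (Real.continuousAt_log (eulerFactor_pos h1 hpp hp le_rfl).ne').tendsto.comp
    (tendsto_eulerFactor hpp hp)

/-! ### Sums over primes -/

/-- For `F : ℕ → ℝ` summable over the primes, the partial sums over `primesBelow n` tend to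
`Σ'_{p prime} F p`. [folklore] -/
lemma tendsto_sum_primesBelow {F : ℕ → ℝ} (hF : Summable fun p : Nat.Primes => F p) :
    Tendsto (fun n => ∑ p ∈ primesBelow n, F p) atTop (𝓝 (∑' p : Nat.Primes, F p)) := by
  have h1 : ∑' p : Nat.Primes, F p = ∑' n : ℕ, {p : ℕ | p.Prime}.indicator F n :=
    tsum_subtype {p : ℕ | p.Prime} F
  have h2 : Summable ({p : ℕ | p.Prime}.indicator F) := summable_subtype_iff_indicator.mp hF
  rw [h1]
  refine h2.hasSum.tendsto_sum_nat.congr fun n => ?_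
  rw [primesBelow, Finset.sum_filter]
  refine Finset.sum_congr rfl fun k _ => ?_
  by_cases hk : k.Prime <;> simp [hk]

/-- Summability over the primes of a function dominated by a summable one on `ℕ`. [folklore] -/
lemma summable_primes_of_summable {F : ℕ → ℝ} (hF : Summable F) :
    Summable fun p : Nat.Primes => F p :=
  hF.subtype _

/-- Auxiliary (proof-internal). [folklore] -/
lemma summable_primes_rpow_neg_two :
    Summable fun p : Nat.Primes => (p : ℝ) ^ (-2 : ℝ) :=
  Nat.Primes.summable_rpow.mpr (by norm_num)

/-! ### The logarithm of the Euler product -/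

section Main

variable (h1 : c 1 = 1) (hmul : ∀ m n : ℕ, m.Coprime n → c (m * n) = c m * c n)
  (hpp : ∀ p e : ℕ, p.Prime → (c (p ^ e) : ℝ) ≤ ((e : ℝ) + 1) ^ D)
  (hsum : ∀ s : ℝ, 1 < s → Summable (term c s))

include h1 hpp in
/-- Auxiliary (proof-internal). [folklore] -/
lemma summable_err {s : ℝ} (hs : 1 ≤ s) : Summable fun p : Nat.Primes => err c s p := by
  refine Summable.of_norm_bounded (summable_primes_rpow_neg_two.mul_left (errConst D)) ?_
  intro p
  rw [Real.norm_eq_abs]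
  exact abs_err_le h1 hpp p.prop hs

include hsum in
/-- Auxiliary (proof-internal). [folklore] -/
lemma summable_term_primes {s : ℝ} (hs : 1 < s) : Summable fun p : Nat.Primes => term c s p :=
  summable_primes_of_summable (hsum s hs)

include h1 hsum in
/-- Auxiliary (proof-internal). [folklore] -/
lemma tsum_term_pos {s : ℝ} (hs : 1 < s) : 0 < ∑' n, term c s n := by
  have := (hsum s hs).le_tsum 1 (fun j _ => term_nonneg s j)
  rw [term_one h1] at this
  linarith

include h1 hmul hpp hsum in
/-- `log Z(s) = Σ_p log E_p(s)` for `s > 1` (Euler product). [folklore] -/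
lemma log_tsum_term_eq {s : ℝ} (hs : 1 < s) :
    Real.log (∑' n, term c s n) = ∑' p : Nat.Primes, Real.log (eulerFactor c s p) := by
  -- Euler product as a limit of finite partial products
  have hE := EulerProduct.eulerProduct (f := term c s) (term_one h1 s)
    (fun {m n} hmn => term_mul hmul s hmn)
    (by simpa [Real.norm_eq_abs, abs_of_nonneg (term_nonneg s _)] using hsum s hs)
    (term_zero (by linarith))
  -- take logarithms
  have hZ := tsum_term_pos h1 hsum hs
  have hlog := ((Real.continuousAt_log hZ.ne').tendsto.comp hE)
  have hA : Tendsto (fun n => ∑ p ∈ primesBelow n, Real.log (eulerFactor c s p)) atTop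
      (𝓝 (Real.log (∑' n, term c s n))) := by
    refine hlog.congr fun n => ?_
    simp only [Function.comp_apply]
    rw [Real.log_prod]
    · rfl
    · intro p hp
      exact (eulerFactor_pos h1 hpp (Nat.mem_primesBelow.mp hp).2 hs.le).ne'
  -- the series of logarithms converges (absolutely)
  have hS : Summable fun p : Nat.Primes => Real.log (eulerFactor c s p) := by
    have := (summable_term_primes hsum hs).add (summable_err h1 hpp hs.le)
    refine this.congr fun p => ?_
    simp [err]
  exact tendsto_nhds_unique hA (tendsto_sum_primesBelow hS)

include h1 hmul hpp hsum in
/-- `Σ_p c(p)p^{-s} + log (s-1) = log ((s-1) Z(s)) - Σ_p r_p(s)` for `s > 1`. [folklore] -/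
lemma tsum_term_primes_add_log_eq {s : ℝ} (hs : 1 < s) :
    ∑' p : Nat.Primes, term c s p + Real.log (s - 1) =
      Real.log ((s - 1) * ∑' n, term c s n) - ∑' p : Nat.Primes, err c s p := by
  have hZ := tsum_term_pos h1 hsum hs
  rw [Real.log_mul (by linarith) hZ.ne', log_tsum_term_eq h1 hmul hpp hsum hs]
  have : ∑' p : Nat.Primes, Real.log (eulerFactor c s p) =
      ∑' p : Nat.Primes, term c s p + ∑' p : Nat.Primes, err c s p := by
    rw [← (summable_term_primes hsum hs).tsum_add (summable_err h1 hpp hs.le)]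
    refine tsum_congr fun p => ?_
    simp [err]
  rw [this]
  ring

include h1 hmul hpp hsum in
/-- **Main result.** If moreover `(s-1) Z(s) → ρ > 0` as `s → 1⁺`, then
`Σ_p c(p) p^{-s} + log (s-1) → log ρ - Σ_p r_p(1)`. [folklore] -/
theorem tendsto_tsum_primes_add_log {ρ : ℝ} (hρ : 0 < ρ)
    (hres : Tendsto (fun s : ℝ => (s - 1) * ∑' n, term c s n) (𝓝[>] 1) (𝓝 ρ)) :
    Tendsto (fun s : ℝ => ∑' p : Nat.Primes, term c s p + Real.log (s - 1)) (𝓝[>] 1)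
      (𝓝 (Real.log ρ - ∑' p : Nat.Primes, err c 1 p)) := by
  have hev : ∀ᶠ s : ℝ in 𝓝[>] 1, Real.log ((s - 1) * ∑' n, term c s n) -
      ∑' p : Nat.Primes, err c s p = ∑' p : Nat.Primes, term c s p + Real.log (s - 1) := by
    filter_upwards [self_mem_nhdsWithin] with s hs
    exact (tsum_term_primes_add_log_eq h1 hmul hpp hsum hs).symm
  refine Tendsto.congr' hev (Tendsto.sub ?_ ?_)
  · exact (Real.continuousAt_log hρ.ne').tendsto.comp hres
  · refine tendsto_tsum_of_dominated_convergence
      (bound := fun p : Nat.Primes => errConst D * (p : ℝ) ^ (-2 : ℝ))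
      (summable_primes_rpow_neg_two.mul_left (errConst D)) (fun p => tendsto_err h1 hpp p.prop) ?_
    filter_upwards [self_mem_nhdsWithin] with s (hs : 1 < s)
    intro p
    rw [Real.norm_eq_abs]
    exact abs_err_le h1 hpp p.prop hs.le

include h1 hmul hpp hsum in
/-- Existential form of `tendsto_tsum_primes_add_log`. [folklore] -/
theorem exists_tendsto_tsum_primes_add_log {ρ : ℝ} (hρ : 0 < ρ)
    (hres : Tendsto (fun s : ℝ => (s - 1) * ∑' n, term c s n) (𝓝[>] 1) (𝓝 ρ)) :
    ∃ L : ℝ, Tendsto (fun s : ℝ => ∑' p : Nat.Primes, (c p : ℝ) * (p : ℝ) ^ (-s) + Real.log (s - 1))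
      (𝓝[>] 1) (𝓝 L) :=
  ⟨_, tendsto_tsum_primes_add_log h1 hmul hpp hsum hρ hres⟩

end Main

end LogEulerProduct

end Literature.NumberTheory.LFunctions
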